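import Mathlib
import Literature.NumberTheory.Transcendental.MultipleZeta

/-!
# The admissible indices of a given weight, as a computable list (solo-informed, s47)

A small tool for the weight tables of the formal period ring (PROGRAMMES XLIV, XLVIII and the
planned weight-8 table): instead of an ad-hoc `2^(n-2)`-way disjunction per weight (as the
Literature does at weight `6` in `MZV.eq_of_isAdmissible_of_weight_eq_six`), we enumerate the
compositions of `n` by structural recursion on a fuel parameter — so that the kernel evaluates the
list by `decide` — and prove once and for all that the admissible indices of weight `n` are exactly
the members of `soloInformedAdmIdx n`.  A statement `∀ s, IsAdmissible s → weight s = n → P s` then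
reduces to finitely many instances `P s` (`soloInformed_forall_admissible_of_weight`).
-/

namespace Summit.KontsevichZagierPeriods.KontsevichZagierPeriods.Theorems

open Literature.NumberTheory.Transcendental

/-- Compositions of `n` (lists of positive integers with sum `n`), computed with structural fuel:
`soloInformedCompsAux f n` is correct whenever `n ≤ f`. The first part is `n - k` where `k`, the
sum of the tail, runs through `0, …, n-1`. -/
def soloInformedCompsAux : ℕ → ℕ → List (List ℕ)
  | _, 0 => [[]]
  | 0, _ + 1 => []
  | f + 1, n + 1 =>
    (List.range (n + 1)).flatMap fun k =>
      (soloInformedCompsAux f k).map fun t => (n + 1 - k) :: t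

/-- The compositions of `n`, first part decreasing, then recursively. -/
def soloInformedComps (n : ℕ) : List (List ℕ) :=
  soloInformedCompsAux n n

/-- The admissible indices of weight `n`: compositions of `n` whose first part (if any) is `≥ 2`. -/
def soloInformedAdmIdx (n : ℕ) : List (List ℕ) :=
  (soloInformedComps n).filter fun s => ∀ a ∈ s.head?, 2 ≤ a

/-- Correctness of the fuelled enumeration. -/
theorem soloInformed_mem_compsAux :
    ∀ {f n : ℕ} {s : List ℕ}, n ≤ f →
      (s ∈ soloInformedCompsAux f n ↔ (∀ i ∈ s, 1 ≤ i) ∧ s.sum = n) := by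
  intro f
  induction f with
  | zero =>
    intro n s hn
    obtain rfl : n = 0 := Nat.le_zero.1 hn
    rw [soloInformedCompsAux]
    refine ⟨?_, ?_⟩
    · intro h
      rw [List.mem_singleton] at h
      subst h
      simp
    · rintro ⟨h1, h2⟩
      cases s with
      | nil => exact List.mem_singleton.2 rfl
      | cons a t =>
        have ha := h1 a (by simp)
        simp only [List.sum_cons] at h2
        omega
  | succ f ih =>
    intro n s hn
    cases n with
    | zero =>
      rw [soloInformedCompsAux]
      refine ⟨?_, ?_⟩
      · intro h
        rw [List.mem_singleton] at h
        subst h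
        simp
      · rintro ⟨h1, h2⟩
        cases s with
        | nil => exact List.mem_singleton.2 rfl
        | cons a t =>
          have ha := h1 a (by simp)
          simp only [List.sum_cons] at h2
          omega
    | succ m =>
      rw [soloInformedCompsAux]
      simp only [List.mem_flatMap, List.mem_range, List.mem_map]
      constructor
      · rintro ⟨k, hk, t, ht, rfl⟩
        have ht' := (ih (s := t) (by omega)).1 ht
        refine ⟨?_, ?_⟩
        · intro i hi
          rcases List.mem_cons.1 hi with rfl | hi
          · omega
          · exact ht'.1 i hi
        · rw [List.sum_cons, ht'.2]
          omega
      · rintro ⟨h1, h2⟩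
        cases s with
        | nil => simp at h2
        | cons a t =>
          have ha := h1 a (by simp)
          rw [List.sum_cons] at h2
          refine ⟨t.sum, by omega, t,
            (ih (s := t) (by omega)).2 ⟨fun i hi => h1 i (by simp [hi]), rfl⟩, ?_⟩
          congr 1
          omega

/-- `s` is a composition of `n` iff its parts are positive and sum to `n`. -/
theorem soloInformed_mem_comps {n : ℕ} {s : List ℕ} :
    s ∈ soloInformedComps n ↔ (∀ i ∈ s, 1 ≤ i) ∧ s.sum = n :=
  soloInformed_mem_compsAux le_rfl

/-- **The admissible indices of weight `n` are exactly the members of `soloInformedAdmIdx n`.** -/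
theorem soloInformed_mem_admIdx {n : ℕ} {s : List ℕ} :
    s ∈ soloInformedAdmIdx n ↔ MZV.IsAdmissible s ∧ MZV.weight s = n := by
  rw [soloInformedAdmIdx, List.mem_filter, soloInformed_mem_comps, decide_eq_true_iff]
  unfold MZV.IsAdmissible MZV.weight
  cases s with
  | nil => simp
  | cons a t =>
    simp only [List.head?_cons, Option.mem_def, Option.some.injEq, forall_eq', ne_eq,
      reduceCtorEq, not_false_eq_true, List.head_cons, forall_const]
    tauto

/-- Reduction of a statement about all admissible indices of weight `n` to the finite list. -/
theorem soloInformed_forall_admissible_of_weight {n : ℕ} {P : List ℕ → Prop}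
    (h : ∀ s ∈ soloInformedAdmIdx n, P s) {s : List ℕ} (hs : MZV.IsAdmissible s)
    (hw : MZV.weight s = n) : P s :=
  h s (soloInformed_mem_admIdx.2 ⟨hs, hw⟩)

/-- The sixteen admissible indices of weight `6`, by kernel evaluation (compare the Literature's
`MZV.eq_of_isAdmissible_of_weight_eq_six`). -/
theorem soloInformed_admIdx_six :
    soloInformedAdmIdx 6 =
      [[6], [5, 1], [4, 2], [4, 1, 1], [3, 3], [3, 2, 1], [3, 1, 2], [3, 1, 1, 1], [2, 4],
        [2, 3, 1], [2, 2, 2], [2, 2, 1, 1], [2, 1, 3], [2, 1, 2, 1], [2, 1, 1, 2],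
        [2, 1, 1, 1, 1]] := by
  decide

/-- There are `32` admissible indices of weight `7` and `64` of weight `8` (`2^(n-2)` in
general). -/
theorem soloInformed_length_admIdx_seven_eight :
    (soloInformedAdmIdx 7).length = 32 ∧ (soloInformedAdmIdx 8).length = 64 := by
  decide

/-- Usage: an admissible index of weight `4` is `(4)`, `(3,1)` or `(2,2)`… read off the list. -/
example {s : List ℕ} (hs : MZV.IsAdmissible s) (hw : MZV.weight s = 4) :
    s = [4] ∨ s = [3, 1] ∨ s = [2, 2] ∨ s = [2, 1, 1] := by
  have h := soloInformed_mem_admIdx.2 ⟨hs, hw⟩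
  rw [show soloInformedAdmIdx 4 = [[4], [3, 1], [2, 2], [2, 1, 1]] from by decide] at h
  simpa using h

end Summit.KontsevichZagierPeriods.KontsevichZagierPeriods.Theorems
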